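import Literature.Analysis.UnboundedOperators.LumerPhillipsCharacterisation
import HarnessLib

/-!
# Lumer–Phillips, complex points: for an `ω`-quasi-dissipative operator with the range condition the whole
  half-plane `{Re λ > ω}` is in the resolvent set, with `(Re λ − ω)‖x‖ ≤ ‖λx − Ax‖` (Engel–Nagel II Thm. 1.10)

Analysis/UnboundedOperators proofs-layer file (theorems only, no definitions, no named facts).
`IsQuasiDissipativeData A ω` (`LumerPhillipsQuasi.lean`) speaks about REAL `λ > ω` only. Through the generated
semigroup (`IsQuasiDissipativeData.exists_c0Semigroup`, `‖T(t)‖ ≤ e^{ωt}`) and the Laplace transform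
`R(λ) = ∫₀^∞ e^{−λt}T(t)dt` (`SemigroupLaplaceResolventGenerator.lean`: `R(λ)(λ − A) = 1_{D(A)}`, `(λ − A)R(λ) = 1`,
`‖R(λ)‖ ≤ 1/(Re λ − ω)`) every COMPLEX `λ` with `Re λ > ω` is a resolvent point:

* `IsQuasiDissipativeData.norm_le_of_lt_re` — `(Re λ − ω)‖x‖ ≤ ‖λx − Ax‖` on `D(A)`;
* `IsQuasiDissipativeData.injective_sub_of_lt_re`, **`IsQuasiDissipativeData.surj_sub_of_lt_re`** — `λ − A` is a
  bijection `D(A) → E`;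
* the contraction case `IsLumerPhillipsData.norm_le_of_re_pos` / `surj_sub_of_re_pos`.

## References

* K.-J. Engel, R. Nagel, *One-Parameter Semigroups for Linear Evolution Equations* (2000), Ch. II
  Thm. 1.10, Thm. 3.15. [EngelNagel2000]
-/

noncomputable section

open MeasureTheory Set Filter
open scoped Topology NNReal

namespace Literature.Analysis.UnboundedOperators

namespace HilleYosida

variable {E : Type*} [NormedAddCommGroup E] [NormedSpace ℂ E] [CompleteSpace E]
variable {A : E →ₗ.[ℂ] E} {ω : ℝ}

omit [CompleteSpace E] in
/-- `∫₀^∞ e^{(ω − Re λ)t} dt = 1/(Re λ − ω)` (with the factor `M = 1`). [folklore] -/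
private theorem one_mul_integral_exp_eq' {ω r : ℝ} (hr : ω < r) :
    (1 * ∫ t in Ioi (0 : ℝ), Real.exp ((ω - r) * t)) = (r - ω)⁻¹ := by
  rw [one_mul, integral_exp_mul_Ioi (by linarith) 0, mul_zero, Real.exp_zero, neg_div, ← div_neg, neg_sub, one_div]

/-- **`(Re λ − ω)‖x‖ ≤ ‖λx − Ax‖` for every complex `λ` with `Re λ > ω`** (via `x = R(λ)(λx − Ax)` and
`‖R(λ)‖ ≤ 1/(Re λ − ω)` for the generated semigroup). [cite: EngelNagel2000, Ch. II Thm. 1.10] -/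
theorem IsQuasiDissipativeData.norm_le_of_lt_re (h : IsQuasiDissipativeData A ω) {l : ℂ} (hl : ω < l.re)
    (x : A.domain) : (l.re - ω) * ‖(x : E)‖ ≤ ‖l • (x : E) - A x‖ := by
  obtain ⟨T, hT, -, hgen⟩ := h.exists_c0Semigroup
  subst hgen
  have hM : ∀ t : ℝ≥0, ‖T.app t‖ ≤ 1 * Real.exp (ω * t) := fun t => by rw [one_mul]; exact hT t
  have h2 := C0Semigroup.norm_laplaceResolventFun_le T hM hl (l • (x : E) - T.generator x)
  rw [C0Semigroup.laplaceResolventFun_sub_generator T hM hl x, one_mul_integral_exp_eq' hl] at h2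
  have hlω : 0 < l.re - ω := sub_pos.2 hl
  calc (l.re - ω) * ‖(x : E)‖ ≤ (l.re - ω) * ((l.re - ω)⁻¹ * ‖l • (x : E) - T.generator x‖) :=
        mul_le_mul_of_nonneg_left h2 hlω.le
    _ = ‖l • (x : E) - T.generator x‖ := by field_simp

/-- `λ − A` is injective on `D(A)` for `Re λ > ω`. [cite: EngelNagel2000, Ch. II Thm. 1.10] -/
theorem IsQuasiDissipativeData.injective_sub_of_lt_re (h : IsQuasiDissipativeData A ω) {l : ℂ} (hl : ω < l.re)
    {x y : A.domain} (hxy : l • (x : E) - A x = l • (y : E) - A y) : x = y := by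
  have hd := h.norm_le_of_lt_re hl (x - y)
  have he : l • ((x - y : A.domain) : E) - A (x - y) = (l • (x : E) - A x) - (l • (y : E) - A y) := by
    rw [LinearPMap.map_sub, Submodule.coe_sub, smul_sub]; abel
  rw [he, hxy, sub_self, norm_zero] at hd
  have hlω : 0 < l.re - ω := sub_pos.2 hl
  have h0 : ‖((x - y : A.domain) : E)‖ = 0 := le_antisymm (by nlinarith [norm_nonneg ((x - y : A.domain) : E)]) (norm_nonneg _)
  rw [Submodule.coe_sub, norm_eq_zero, sub_eq_zero] at h0
  exact Subtype.ext h0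

/-- **`λ − A` is onto for every complex `λ` with `Re λ > ω`** (`x = R(λ)y`, the Laplace transform of the
generated semigroup). [cite: EngelNagel2000, Ch. II Thm. 1.10] -/
theorem IsQuasiDissipativeData.surj_sub_of_lt_re (h : IsQuasiDissipativeData A ω) {l : ℂ} (hl : ω < l.re) (y : E) :
    ∃ x : A.domain, l • (x : E) - A x = y := by
  obtain ⟨T, hT, -, hgen⟩ := h.exists_c0Semigroup
  subst hgen
  have hM : ∀ t : ℝ≥0, ‖T.app t‖ ≤ 1 * Real.exp (ω * t) := fun t => by rw [one_mul]; exact hT t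
  refine ⟨⟨T.laplaceResolventFun l y, C0Semigroup.laplaceResolventFun_mem_generator_domain T hM hl y⟩, ?_⟩
  rw [C0Semigroup.generator_laplaceResolventFun T hM hl y]
  exact sub_sub_cancel _ _

/-- Contraction case: `Re λ‖x‖ ≤ ‖λx − Ax‖` for `Re λ > 0`. [cite: EngelNagel2000, Ch. II Thm. 3.15] -/
theorem IsLumerPhillipsData.norm_le_of_re_pos (h : IsLumerPhillipsData A) {l : ℂ} (hl : 0 < l.re) (x : A.domain) :
    l.re * ‖(x : E)‖ ≤ ‖l • (x : E) - A x‖ := by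
  simpa using h.isQuasiDissipativeData.norm_le_of_lt_re hl x

/-- Contraction case: `λ − A` is onto for `Re λ > 0`. [cite: EngelNagel2000, Ch. II Thm. 3.15] -/
theorem IsLumerPhillipsData.surj_sub_of_re_pos (h : IsLumerPhillipsData A) {l : ℂ} (hl : 0 < l.re) (y : E) :
    ∃ x : A.domain, l • (x : E) - A x = y :=
  h.isQuasiDissipativeData.surj_sub_of_lt_re hl y

end HilleYosida

end Literature.Analysis.UnboundedOperators
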